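import Mathlib
import HarnessLib
import Literature.MathematicalPhysics.QuantumLattice.HubbardSectorPhaseSpaceCount
import Summits.HubbardSuperconductivity.HubbardSuperconductivity.Theorems.KLProgrammeKLRegimeSplitEngineV4Sums
import Summits.HubbardSuperconductivity.HubbardSuperconductivity.Theorems.KLProgrammeKLRegimeVolumeLimitDefs

/-!
# Route `KLProgramme` — crux K3 split, ENGINE child: the THERMAL LAYER in scales, the `thermalBar` dictionary, and the (T) sums
# over the EXTENDED ladder `n ≤ n_β + 1` (cell gate-hubbard-kl, seat hubbard-kl-k3c2-p2 «thermal-bar induction n ≤ nScales β + 1»)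

The engine slot of record (`EngineBoundsAtV4S`, p1's `…SplitEngineV4` + p1b's `…SplitSpin01`) carries in its three value-increment
clauses the thermal-layer majorant `thermalBar G P U β n = CF·(Klam U)²·4^{-(n_β − n)}` (ℕ-subtraction), `n_β = nScales β =
⌊log₄(e₀β/π)⌋`.  Its analytic origin (DECOMP App. E Lemma E.2 (ii)/(iii), HOME/p1/E2-NOTE.md §3 STEP 3, §4): at scale `n` the
single-slice particle–hole bubble is a DISCRETE Matsubara sum over `k₀ ∈ π(2ℤ+1)/β`; replacing it by the `k₀`-integral (where the
`(k₀, ξ)`-rotation cancellation of E.2 STEP 4 acts) costs the Riemann-sum error, of relative size «temperature / scale» `= (π/β)/Λ_n`;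
at the last scales `n ∈ {n_β − 1, n_β, n_β + 1}` this ratio is `O(1)` (the thermal layer), above them it decays like `4^{-(n_β − n)}`.
The ladder of the v3 generic children (`EngineP3`, `…SplitGenericV3`) runs to `n ≤ n_β + 1` (the fully integrated action,
`klScale_nScales_succ_lt`), one step beyond the range `N ≤ n_β` of p1's `thermalBar_sum_le`.

This module (pure real arithmetic on the tree's `klScale`, `klTempScaleIdx`, `thermalBar`; nothing about the model is asserted):
* §1 the thermal layer in scales: `π/β ≤ Λ_{n_β} < 4π/β` for `β ≥ klBetaMin`, `Λ_n < π/β` for `n > n_β`, and the DICTIONARY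
  `(π/β)/Λ_n ≤ 4^{-(n_β − n)} < 4(π/β)/Λ_n` (`n ≤ n_β`): an engine prover who bounds the Matsubara-discretisation error at scale `n` by
  `C·(Klam U)²·(π/β)/Λ_n` (the natural output of a Riemann-sum estimate) has it `≤ thermalBar G P U β n` as soon as `C ≤ G.CF`
  (`klth_ratio_mul_le_thermalBar`, and the all-scales form with `min 1 (…)`);
* §2 `thermalBar` on the extended ladder: `= CF·(Klam U)²` at every `n ≥ n_β` (in particular at the last index `n_β + 1`), monotone in `n`;
* §3 the (T) sums over the EXTENDED ladder: `Σ_{n ≤ N} thermalBar ≤ (7/3)·CF·(Klam U)²` and `Σ_{n ∈ Ioc t N} ≤ (7/3)·…` for `N ≤ n_β + 1`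
  (the constant a consumer of the tower up to `n_β + 1` pays; `4/3` below the last index, `+1` at it);
* §4 the number of kept Matsubara frequencies below scale `Λ_n` is `≤ 7·4^{n_β − n}` (`n ≤ n_β`; from the tree's
  `card_filter_matsubaraFreq_le`): the thermal layer has `O(1)` frequencies per slice — the sign-blind companion of §1.
References: BGM 2006 = Benfatto–Giuliani–Mastropietro, Ann. Henri Poincaré 7 (2006) 809, §2.3 (2.31a), (2.38); HOME/p1/E2-NOTE.md §3–§5;
HOME/prover-p1b/GAINS-NOTE.md §5.2 (T); `…SplitEngineV4` (p444106), `…SplitEngineV4Sums` (p444942), `…SplitGenericV3` (p448713).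
-/

noncomputable section

namespace Summit.HubbardSuperconductivity.HubbardSuperconductivity.Theorems.KLRegimeSplit

set_option linter.dupNamespace false -- summit = problem name (single-conjunct summit), D-0017

open Real Finset Literature.MathematicalPhysics.QuantumLattice Literature.Probability.LatticeModels
open Summit.HubbardSuperconductivity.HubbardSuperconductivity.Theorems.KLProgrammeLegKernels

/-! ## §1 The thermal layer in scales -/

/-- `Λ_n = e₀ 4^{-n} > 0`. -/
theorem klth_klScale_pos (n : ℕ) : 0 < klScale klE0 n := by
  unfold klScale klE0; positivity

/-- One step down the ladder divides the scale by `4`: `Λ_{n+1} = Λ_n / 4`. -/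
theorem klth_klScale_succ (n : ℕ) : klScale klE0 (n + 1) = klScale klE0 n / 4 := by
  unfold klScale; rw [pow_succ]; field_simp

/-- `Λ_m / Λ_n = 4^n / 4^m`, i.e. for `n ≤ m`: `Λ_m / Λ_n = (4^{m-n})⁻¹`. -/
theorem klth_klScale_div_klScale {n m : ℕ} (h : n ≤ m) :
    klScale klE0 m / klScale klE0 n = ((4 : ℝ) ^ (m - n))⁻¹ := by
  have he : (0 : ℝ) < klE0 := by norm_num [klE0]
  unfold klScale
  rw [pow_sub₀ (4 : ℝ) (by norm_num) h]
  field_simp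

/-- In the multiscale regime `β ≥ klBetaMin = 128` the floor argument of `n_β` is at least `1`: `1 ≤ e₀β/π`. -/
theorem klth_one_le_klE0_mul_div_pi {β : ℝ} (hβ : klBetaMin ≤ β) : 1 ≤ klE0 * β / Real.pi := by
  rw [le_div_iff₀ Real.pi_pos, klE0]
  have : (128 : ℝ) ≤ β := by simpa [klBetaMin] using hβ
  nlinarith [Real.pi_lt_four]

/-- **The temperature is below the last scale**: `π/β ≤ Λ_{n_β}` for `β ≥ klBetaMin`
(`n_β = ⌊log₄(e₀β/π)⌋ ≤ log₄(e₀β/π)`, so `4^{n_β} ≤ e₀β/π`; BGM 2006 (2.31a)/(2.38)). -/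
theorem klth_pi_div_le_klScale_nScales {β : ℝ} (hβ : klBetaMin ≤ β) :
    Real.pi / β ≤ klScale klE0 (nScales β) := by
  have hβ0 : 0 < β := pos_of_klBetaMin_le hβ
  have hx1 := klth_one_le_klE0_mul_div_pi hβ
  have hx : 0 < klE0 * β / Real.pi := lt_of_lt_of_le one_pos hx1
  set y : ℝ := Real.logb 4 (klE0 * β / Real.pi) with hy
  have hy0 : 0 ≤ y := Real.logb_nonneg (by norm_num) hx1
  -- `4^{n_β} ≤ e₀β/π`
  have hpow : (4 : ℝ) ^ (nScales β) ≤ klE0 * β / Real.pi := by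
    have hfl : ((nScales β : ℕ) : ℝ) ≤ y := Nat.floor_le hy0
    have h1 : (4 : ℝ) ^ ((nScales β : ℕ) : ℝ) ≤ (4 : ℝ) ^ y :=
      Real.rpow_le_rpow_of_exponent_le (by norm_num) hfl
    rw [Real.rpow_natCast] at h1
    have h2 : (4 : ℝ) ^ y = klE0 * β / Real.pi := by
      rw [hy]; exact Real.rpow_logb (by norm_num) (by norm_num) hx
    rw [h2] at h1
    exact h1
  have h4 : (0 : ℝ) < (4 : ℝ) ^ (nScales β) := by positivity
  unfold klScale
  rw [div_le_iff₀ hβ0]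
  rw [le_div_iff₀ Real.pi_pos] at hpow
  calc Real.pi = Real.pi * (4 : ℝ) ^ nScales β * ((4 : ℝ) ^ nScales β)⁻¹ := by field_simp
    _ ≤ klE0 * β * ((4 : ℝ) ^ nScales β)⁻¹ := by
        apply mul_le_mul_of_nonneg_right _ (by positivity); linarith
    _ = klE0 * ((4 : ℝ) ^ nScales β)⁻¹ * β := by ring

/-- **The last scale is within a factor `4` of the temperature**: `Λ_{n_β} < 4π/β` (`β > 0`; from `Λ_{n_β+1} < π/β`). -/
theorem klth_klScale_nScales_lt {β : ℝ} (hβ : 0 < β) : klScale klE0 (nScales β) < 4 * (Real.pi / β) := by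
  have h := klScale_nScales_succ_lt hβ
  rw [klth_klScale_succ] at h
  linarith

/-- **Below the thermal layer nothing is left**: `Λ_n < π/β` for every `n > n_β` (`β > 0`). -/
theorem klth_klScale_lt_pi_div {β : ℝ} (hβ : 0 < β) {n : ℕ} (hn : nScales β < n) : klScale klE0 n < Real.pi / β := by
  have h1 : klScale klE0 n ≤ klScale klE0 (nScales β + 1) := by
    unfold klScale
    have he : (0 : ℝ) < klE0 := by norm_num [klE0]
    refine mul_le_mul_of_nonneg_left ?_ he.le
    exact inv_anti₀ (by positivity) (pow_le_pow_right₀ (by norm_num) hn)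
  exact lt_of_le_of_lt h1 (klScale_nScales_succ_lt hβ)

/-- **The dictionary, lower half**: for `n ≤ n_β` and `β ≥ klBetaMin`, the temperature-to-scale ratio is below the thermal profile,
`(π/β)/Λ_n ≤ 4^{-(n_β − n)}` (`= Λ_{n_β}/Λ_n` and `π/β ≤ Λ_{n_β}`). -/
theorem klth_ratio_le_inv_pow {β : ℝ} (hβ : klBetaMin ≤ β) {n : ℕ} (hn : n ≤ nScales β) :
    (Real.pi / β) / klScale klE0 n ≤ ((4 : ℝ) ^ (nScales β - n))⁻¹ := by
  rw [← klth_klScale_div_klScale hn]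
  exact div_le_div_of_nonneg_right (klth_pi_div_le_klScale_nScales hβ) (klth_klScale_pos n).le

/-- **The dictionary, upper half**: for `n ≤ n_β` (`β > 0`), `4^{-(n_β − n)} < 4·(π/β)/Λ_n` — the thermal profile is, up to the
factor `4`, exactly the temperature-to-scale ratio. -/
theorem klth_inv_pow_lt_four_mul_ratio {β : ℝ} (hβ : 0 < β) {n : ℕ} (hn : n ≤ nScales β) :
    ((4 : ℝ) ^ (nScales β - n))⁻¹ < 4 * ((Real.pi / β) / klScale klE0 n) := by
  rw [← klth_klScale_div_klScale hn, mul_div_assoc']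
  exact div_lt_div_of_pos_right (klth_klScale_nScales_lt hβ) (klth_klScale_pos n)

/-- For every scale (also beyond `n_β`): `min 1 ((π/β)/Λ_n) ≤ 4^{-(n_β − n)}` (`β ≥ klBetaMin`; for `n > n_β` the right side is `1`). -/
theorem klth_min_one_ratio_le_inv_pow {β : ℝ} (hβ : klBetaMin ≤ β) (n : ℕ) :
    min 1 ((Real.pi / β) / klScale klE0 n) ≤ ((4 : ℝ) ^ (nScales β - n))⁻¹ := by
  rcases le_or_gt n (nScales β) with hn | hn
  · exact (min_le_right _ _).trans (klth_ratio_le_inv_pow hβ hn)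
  · have : nScales β - n = 0 := Nat.sub_eq_zero_of_le hn.le
    rw [this, pow_zero, inv_one]
    exact min_le_left _ _

/-! ## §2 `thermalBar` on the extended ladder -/

/-- Below the last scale `thermalBar` IS `CF·(Klam U)²·Λ_{n_β}/Λ_n` (`n ≤ n_β`). -/
theorem klth_thermalBar_eq_of_le (G : GeoConsts) (P : SplitConsts) (U β : ℝ) {n : ℕ} (hn : n ≤ nScales β) :
    thermalBar G P U β n = G.CF * (P.Klam * U) ^ 2 * (klScale klE0 (nScales β) / klScale klE0 n) := by
  rw [thermalBar, klth_klScale_div_klScale hn]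

/-- **In and below the thermal layer the majorant is the full second-order unit**: `thermalBar G P U β n = CF·(Klam U)²` for
`n ≥ n_β` — in particular at the last index `n_β + 1` of the v3 ladder (`EngineP3`). -/
theorem klth_thermalBar_eq_of_nScales_le (G : GeoConsts) (P : SplitConsts) (U β : ℝ) {n : ℕ} (hn : nScales β ≤ n) :
    thermalBar G P U β n = G.CF * (P.Klam * U) ^ 2 := by
  rw [thermalBar, Nat.sub_eq_zero_of_le hn, pow_zero, inv_one, mul_one]

/-- `thermalBar` at the last index of the extended ladder. -/
theorem klth_thermalBar_nScales_succ (G : GeoConsts) (P : SplitConsts) (U β : ℝ) :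
    thermalBar G P U β (nScales β + 1) = G.CF * (P.Klam * U) ^ 2 :=
  klth_thermalBar_eq_of_nScales_le G P U β (Nat.le_succ _)

/-- `thermalBar` is monotone along the ladder (`0 ≤ CF`): the thermal unit grows geometrically towards the temperature scale. -/
theorem klth_thermalBar_mono {G : GeoConsts} (hG : 0 ≤ G.CF) (P : SplitConsts) (U β : ℝ) :
    Monotone (thermalBar G P U β) := by
  intro a b hab
  unfold thermalBar
  refine mul_le_mul_of_nonneg_left ?_ (by positivity)
  exact inv_anti₀ (by positivity) (pow_le_pow_right₀ (by norm_num) (by omega))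

/-- **The dictionary at the slot**: a Matsubara-discretisation error of the natural form `C·(Klam U)²·(π/β)/Λ_n` with `0 ≤ C ≤ CF` is
`≤ thermalBar G P U β n` (`n ≤ n_β`, `β ≥ klBetaMin`). -/
theorem klth_ratio_mul_le_thermalBar {G : GeoConsts} {C : ℝ} (hC : 0 ≤ C) (hCF : C ≤ G.CF) (P : SplitConsts) (U : ℝ) {β : ℝ}
    (hβ : klBetaMin ≤ β) {n : ℕ} (hn : n ≤ nScales β) :
    C * (P.Klam * U) ^ 2 * ((Real.pi / β) / klScale klE0 n) ≤ thermalBar G P U β n := by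
  unfold thermalBar
  have h1 := klth_ratio_le_inv_pow hβ hn
  have h2 : 0 ≤ (Real.pi / β) / klScale klE0 n :=
    div_nonneg (div_nonneg Real.pi_pos.le (pos_of_klBetaMin_le hβ).le) (klth_klScale_pos n).le
  have hGC : 0 ≤ G.CF := hC.trans hCF
  calc C * (P.Klam * U) ^ 2 * ((Real.pi / β) / klScale klE0 n)
      ≤ G.CF * (P.Klam * U) ^ 2 * ((Real.pi / β) / klScale klE0 n) :=
        mul_le_mul_of_nonneg_right (mul_le_mul_of_nonneg_right hCF (sq_nonneg _)) h2
    _ ≤ G.CF * (P.Klam * U) ^ 2 * ((4 : ℝ) ^ (nScales β - n))⁻¹ :=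
        mul_le_mul_of_nonneg_left h1 (by positivity)

/-- **The dictionary at the slot, all scales**: `C·(Klam U)²·min{1, (π/β)/Λ_n} ≤ thermalBar G P U β n` for every `n` (`0 ≤ C ≤ CF`,
`β ≥ klBetaMin`) — the form usable uniformly on the extended ladder `n ≤ n_β + 1`. -/
theorem klth_min_mul_le_thermalBar {G : GeoConsts} {C : ℝ} (hC : 0 ≤ C) (hCF : C ≤ G.CF) (P : SplitConsts) (U : ℝ) {β : ℝ}
    (hβ : klBetaMin ≤ β) (n : ℕ) :
    C * (P.Klam * U) ^ 2 * min 1 ((Real.pi / β) / klScale klE0 n) ≤ thermalBar G P U β n := by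
  unfold thermalBar
  have h1 := klth_min_one_ratio_le_inv_pow hβ n
  have h2 : 0 ≤ min 1 ((Real.pi / β) / klScale klE0 n) :=
    le_min zero_le_one (div_nonneg (div_nonneg Real.pi_pos.le (pos_of_klBetaMin_le hβ).le) (klth_klScale_pos n).le)
  have hGC : 0 ≤ G.CF := hC.trans hCF
  calc C * (P.Klam * U) ^ 2 * min 1 ((Real.pi / β) / klScale klE0 n)
      ≤ G.CF * (P.Klam * U) ^ 2 * min 1 ((Real.pi / β) / klScale klE0 n) :=
        mul_le_mul_of_nonneg_right (mul_le_mul_of_nonneg_right hCF (sq_nonneg _)) h2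
    _ ≤ G.CF * (P.Klam * U) ^ 2 * ((4 : ℝ) ^ (nScales β - n))⁻¹ :=
        mul_le_mul_of_nonneg_left h1 (by positivity)

/-! ## §3 The (T) sums over the extended ladder `n ≤ n_β + 1` -/

/-- `Σ_{n ≤ N} 4^{-(Nβ − n)} ≤ 7/3` for `N ≤ Nβ + 1`: `4/3` from the scales `≤ Nβ` (`sum_inv_four_pow_reflect_le`) plus the single
term `1` at `Nβ + 1`. -/
theorem klth_sum_inv_four_pow_reflect_le_succ {Nβ N : ℕ} (hN : N ≤ Nβ + 1) :
    ∑ n ∈ range (N + 1), ((4 : ℝ) ^ (Nβ - n))⁻¹ ≤ 7 / 3 := by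
  rcases Nat.lt_or_ge N (Nβ + 1) with hlt | hge
  · exact (sum_inv_four_pow_reflect_le (Nat.lt_succ_iff.mp hlt)).trans (by norm_num)
  · have hEq : N = Nβ + 1 := le_antisymm hN hge
    subst hEq
    rw [sum_range_succ, Nat.sub_eq_zero_of_le (Nat.le_succ _), pow_zero, inv_one]
    have h := sum_inv_four_pow_reflect_le (le_refl Nβ)
    linarith

/-- **(T) summed over the extended ladder**: `Σ_{n ≤ N} thermalBar G P U β n ≤ (7/3)·CF·(Klam U)²` for `N ≤ n_β + 1`. -/
theorem klth_thermalBar_sum_le_succ {G : GeoConsts} (hG : 0 ≤ G.CF) (P : SplitConsts) (U β : ℝ) {N : ℕ}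
    (hN : N ≤ nScales β + 1) :
    ∑ n ∈ range (N + 1), thermalBar G P U β n ≤ 7 / 3 * (G.CF * (P.Klam * U) ^ 2) := by
  simp only [thermalBar, ← Finset.mul_sum]
  rw [mul_comm (7 / 3 : ℝ)]
  exact mul_le_mul_of_nonneg_left (klth_sum_inv_four_pow_reflect_le_succ hN) (by positivity)

/-- `Σ_{n ∈ Ioc t N} 4^{-(Nβ − n)} ≤ 7/3` for `N ≤ Nβ + 1` (a sub-sum of the previous one). -/
theorem klth_sum_Ioc_inv_four_pow_reflect_le_succ {Nβ t N : ℕ} (hN : N ≤ Nβ + 1) :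
    ∑ n ∈ Ioc t N, ((4 : ℝ) ^ (Nβ - n))⁻¹ ≤ 7 / 3 := by
  refine le_trans ?_ (klth_sum_inv_four_pow_reflect_le_succ hN)
  refine sum_le_sum_of_subset_of_nonneg ?_ fun n _ _ => by positivity
  intro n hn
  rw [mem_Ioc] at hn
  rw [mem_range]
  omega

/-- **(T) summed between two scales of the extended ladder**: `Σ_{n ∈ Ioc t N} thermalBar G P U β n ≤ (7/3)·CF·(Klam U)²` for
`N ≤ n_β + 1` (the shape of p1b's `klbf_sum_Ioc_thermal_le`, one index further). -/
theorem klth_thermalBar_sum_Ioc_le_succ {G : GeoConsts} (hG : 0 ≤ G.CF) (P : SplitConsts) (U β : ℝ) {t N : ℕ}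
    (hN : N ≤ nScales β + 1) :
    ∑ n ∈ Ioc t N, thermalBar G P U β n ≤ 7 / 3 * (G.CF * (P.Klam * U) ^ 2) := by
  simp only [thermalBar, ← Finset.mul_sum]
  rw [mul_comm (7 / 3 : ℝ)]
  exact mul_le_mul_of_nonneg_left (klth_sum_Ioc_inv_four_pow_reflect_le_succ hN) (by positivity)

/-- The generic form with an arbitrary nonnegative constant: `Σ_{n ∈ Ioc t N} C·4^{-(Nβ − n)} ≤ (7/3)·C` for `N ≤ Nβ + 1`. -/
theorem klth_sum_Ioc_thermal_le_succ {C : ℝ} (hC : 0 ≤ C) {t N Nβ : ℕ} (hN : N ≤ Nβ + 1) :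
    ∑ n ∈ Ioc t N, C * ((4 : ℝ) ^ (Nβ - n))⁻¹ ≤ 7 / 3 * C := by
  rw [← mul_sum, mul_comm (7 / 3 : ℝ)]
  exact mul_le_mul_of_nonneg_left (klth_sum_Ioc_inv_four_pow_reflect_le_succ hN) hC

/-! ## §4 Matsubara frequencies below a scale: the thermal layer has `O(1)` of them -/

/-- **At most `7·4^{n_β − n}` kept Matsubara frequencies lie below scale `Λ_n`** (`n ≤ n_β`, `β ≥ klBetaMin`, any `M`): a set of
indices `i` with `|ω_i| ≤ Λ_n` has `card ≤ Λ_n β/π + 3 ≤ 4·4^{n_β−n} + 3` (the tree's `card_filter_matsubaraFreq_le` and §1). -/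
theorem klth_card_matsubara_below_scale_le {β : ℝ} (hβ : klBetaMin ≤ β) {M : ℕ} {n : ℕ} (hn : n ≤ nScales β)
    (S : Finset (MatsubaraIdx M)) (hS : ∀ i ∈ S, |matsubaraFreq β M i| ≤ klScale klE0 n) :
    (S.card : ℝ) ≤ 7 * (4 : ℝ) ^ (nScales β - n) := by
  have hβ0 : 0 < β := pos_of_klBetaMin_le hβ
  have h1 := card_filter_matsubaraFreq_le hβ0 (klth_klScale_pos n).le S hS
  -- `Λ_n β / π < 4^{n_β - n + 1}`: from `Λ_{n_β} < 4π/β` and `Λ_n = 4^{n_β - n} Λ_{n_β}`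
  have h2 : klScale klE0 n * β / Real.pi ≤ 4 * (4 : ℝ) ^ (nScales β - n) := by
    have hr : klScale klE0 n = (4 : ℝ) ^ (nScales β - n) * klScale klE0 (nScales β) := by
      have h := klth_klScale_div_klScale hn
      have hpos := klth_klScale_pos n
      have h4 : (0 : ℝ) < (4 : ℝ) ^ (nScales β - n) := by positivity
      field_simp at h
      linarith [h]
    have hlt := klth_klScale_nScales_lt hβ0
    rw [div_le_iff₀ Real.pi_pos, hr]
    have h4 : (0 : ℝ) ≤ (4 : ℝ) ^ (nScales β - n) := by positivity
    have : klScale klE0 (nScales β) * β ≤ 4 * Real.pi := by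
      have hlt' : klScale klE0 (nScales β) < 4 * Real.pi / β := by rwa [mul_div_assoc]
      exact ((lt_div_iff₀ hβ0).mp hlt').le
    nlinarith
  have h3 : (1 : ℝ) ≤ (4 : ℝ) ^ (nScales β - n) := one_le_pow₀ (by norm_num)
  linarith

end Summit.HubbardSuperconductivity.HubbardSuperconductivity.Theorems.KLRegimeSplit

end
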